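import Mathlib
import HarnessLib
import Summits.AtomisticToContinuum.FouriersLaw.Theses.JunctionLocality
import Literature.MathematicalPhysics.KineticTheory.LangevinChainGibbs

/-!
# The γ-probed device at equilibrium, I: the Gibbs state is a weak steady state of the device

Helper file (`--supports` stmt-AtomisticToContinuum-11748) for the line
`thermalise-then-cut-probe-insertion` of the crux `JunctionLocality.SuperadditiveResistance`, stub
`stub_linearResponse` (fixed-`N` linear-response package). Part I of five
(`…DeviceGibbs`, `…DeviceLineCalculus`, `…DeviceCutoff`, `…DeviceEnergy`, `…DeviceLiouville`; the
overview of the whole development is the module docstring of `…DeviceLiouville`).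

Content: the device vocabulary `kin`, `thermo`, `deviceGenerator` (VERBATIM copies of the line's
skeleton vocabulary, kept in this namespace so that stub files — which re-declare the vocabulary in
the crux namespace — can import these files; the copies are definitionally equal, statements
transfer by `exact`), fluctuation–dissipation at any thermostatted site
(`integral_thermo_gibbsMeasure`, any `OscillatorChain` with `C¹` potentials), and
`pinnedChain_isDeviceSteadyState_gibbsMeasure`: for `pinnedChain ω₂ lam β γ` (`ω₂ > 0`,
`lam, β ≥ 0`) and all four terminal temperatures equal to `T > 0`, the Gibbs state `μ_T` is a weak
steady state of the device with integrable kinetic temperatures (the line's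
`IsDeviceSteadyState … (fun _ => T) μ_T`, unfolded) — the `ε = 0` anchor of the device's linear
response (DeviceFrame (v)) and the `τ ≡ T` case of DeviceFrame (i).
-/

noncomputable section

open MeasureTheory Filter Topology ProbabilityTheory
open scoped ContDiff NNReal
open Literature.MathematicalPhysics.KineticTheory.HeatConduction

namespace Summit.AtomisticToContinuum.FouriersLaw.Theorems.SuperadditiveResistance.DeviceLiouville

/-! ## Device vocabulary (verbatim copies of the line's skeleton vocabulary) -/

/-- `p_s²` of site `s` (as a `Fin`-proof-free sum; `0` if `s ≥ L`). (Verbatim copy of the line's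
`kin`.) [folklore] -/
def kin (L s : ℕ) (x : PhaseSpace L) : ℝ :=
  ∑ i : Fin L, if i.val = s then x.2 i ^ 2 else 0

/-- Ornstein–Uhlenbeck thermostat of temperature `θ` (strength 1) acting on the momentum `p_s`:
`θ ∂²_{p_s} f − p_s ∂_{p_s} f`. (Verbatim copy of the line's `thermo`.) [folklore] -/
def thermo (L s : ℕ) (θ : ℝ) (f : PhaseSpace L → ℝ) (x : PhaseSpace L) : ℝ :=
  ∑ i : Fin L, if i.val = s then θ * partialP i (partialP i f) x - x.2 i * partialP i f x else 0

variable (P : OscillatorChain) in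
/-- Generator of the DEVICE: the `(N+M)`-chain `P` between its end baths (temperatures `τ 0`,
`τ 3`) with two additional Langevin thermostats of the chain's own strength `P.γ` on the junction
momenta `p_{N−1}` (temperature `τ 1`) and `p_N` (temperature `τ 2`); the junction bond is kept.
(Verbatim copy of the line's `deviceGenerator`.) [folklore] -/
def deviceGenerator (N M : ℕ) (τ : Fin 4 → ℝ) (f : PhaseSpace (N + M) → ℝ)
    (x : PhaseSpace (N + M)) : ℝ :=
  P.generator (N + M) (τ 0) (τ 3) f x +
    P.γ * (thermo (N + M) (N - 1) (τ 1) f x + thermo (N + M) N (τ 2) f x)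

/-! ## The Gibbs state is an equilibrium steady state of the device -/

section Helpers

variable {L : ℕ}

/-- `kin L s x = p_s²` for a site `s < L`. [folklore] -/
theorem kin_eq_sq {s : ℕ} (hs : s < L) (x : PhaseSpace L) : kin L s x = x.2 ⟨s, hs⟩ ^ 2 := by
  unfold kin
  rw [Finset.sum_eq_single_of_mem (⟨s, hs⟩ : Fin L) (Finset.mem_univ _)]
  · simp
  · intro b _ hb
    rw [if_neg]
    exact fun h => hb (Fin.ext h)

/-- `kin L s = 0` when `s` is not a site (`L ≤ s`). [folklore] -/
theorem kin_eq_zero_of_le {s : ℕ} (hs : L ≤ s) (x : PhaseSpace L) : kin L s x = 0 := by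
  unfold kin
  refine Finset.sum_eq_zero fun i _ => ?_
  rw [if_neg]
  intro h
  have := i.isLt
  omega

/-- `0 ≤ kin L s x`. [folklore] -/
theorem kin_nonneg (s : ℕ) (x : PhaseSpace L) : 0 ≤ kin L s x :=
  Finset.sum_nonneg fun i _ => by split_ifs <;> positivity

/-- `kin L s x ≤ ∑_i p_i²`. [folklore] -/
theorem kin_le_sum_sq (s : ℕ) (x : PhaseSpace L) : kin L s x ≤ ∑ i, x.2 i ^ 2 :=
  Finset.sum_le_sum fun i _ => by split_ifs <;> nlinarith [sq_nonneg (x.2 i)]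

/-- `kin L s` is continuous. [folklore] -/
theorem continuous_kin (s : ℕ) : Continuous (kin L s) := by
  unfold kin
  refine continuous_finsetSum _ fun i _ => ?_
  split_ifs
  · fun_prop
  · exact continuous_const

/-- `thermo L s θ f x = θ ∂²_{p_s} f − p_s ∂_{p_s} f` for a site `s < L`. [folklore] -/
theorem thermo_eq {s : ℕ} (hs : s < L) (θ : ℝ) (f : PhaseSpace L → ℝ) (x : PhaseSpace L) :
    thermo L s θ f x =
      θ * partialP ⟨s, hs⟩ (partialP ⟨s, hs⟩ f) x - x.2 ⟨s, hs⟩ * partialP ⟨s, hs⟩ f x := by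
  unfold thermo
  rw [Finset.sum_eq_single_of_mem (⟨s, hs⟩ : Fin L) (Finset.mem_univ _)]
  · simp
  · intro b _ hb
    rw [if_neg]
    exact fun h => hb (Fin.ext h)

/-- `thermo L s θ f = 0` when `s` is not a site (`L ≤ s`). [folklore] -/
theorem thermo_eq_zero_of_le {s : ℕ} (hs : L ≤ s) (θ : ℝ) (f : PhaseSpace L → ℝ)
    (x : PhaseSpace L) : thermo L s θ f x = 0 := by
  unfold thermo
  refine Finset.sum_eq_zero fun i _ => ?_
  rw [if_neg]
  intro h
  have := i.isLt
  omega

/-- `thermo` is linear in the temperature slot: `thermo θ f = thermo 0 f + θ ∂²_{p_s} f`-type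
splitting, in the form `thermo (θ + θ') f = thermo θ f + θ' Σ_i [i=s] ∂²_{p_i} f`. [folklore] -/
theorem thermo_add_temp (s : ℕ) (θ θ' : ℝ) (f : PhaseSpace L → ℝ) (x : PhaseSpace L) :
    thermo L s (θ + θ') f x =
      thermo L s θ f x + θ' * ∑ i : Fin L, if i.val = s then partialP i (partialP i f) x else 0 := by
  unfold thermo
  rw [Finset.mul_sum, ← Finset.sum_add_distrib]
  refine Finset.sum_congr rfl fun i _ => ?_
  split_ifs <;> ring

/-- For `f ∈ C²` with compact support, `thermo L s θ f` is continuous. [folklore] -/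
theorem continuous_thermo (s : ℕ) (θ : ℝ) {f : PhaseSpace L → ℝ} (hf : ContDiff ℝ 2 f) :
    Continuous (thermo L s θ f) := by
  have h2 : (2 : WithTop ℕ∞) ≠ 0 := by norm_num
  have hp : ∀ i : Fin L, Continuous (partialP i f) := fun i => continuous_partialP hf h2 i
  have hpp : ∀ i : Fin L, Continuous (partialP i (partialP i f)) := fun i =>
    continuous_partialP (contDiff_partialP hf (m := 1) (by norm_num) i) one_ne_zero i
  unfold thermo
  refine continuous_finsetSum _ fun i _ => ?_
  split_ifs
  · exact (continuous_const.mul (hpp i)).sub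
      (((continuous_apply i).comp continuous_snd).mul (hp i))
  · exact continuous_const

/-- For `f ∈ C²` with compact support, `thermo L s θ f` has compact support. [folklore] -/
theorem hasCompactSupport_thermo (s : ℕ) (θ : ℝ) {f : PhaseSpace L → ℝ} (hf : ContDiff ℝ 2 f)
    (hfc : HasCompactSupport f) : HasCompactSupport (thermo L s θ f) := by
  have hd : Differentiable ℝ f := hf.differentiable (by norm_num)
  have hd1 : ∀ i : Fin L, Differentiable ℝ (partialP i f) := fun i =>
    (contDiff_partialP hf (m := 1) (by norm_num) i).differentiable one_ne_zero
  have hp : ∀ i : Fin L, HasCompactSupport (partialP i f) := fun i =>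
    hasCompactSupport_partialP hd hfc i
  have hpp : ∀ i : Fin L, HasCompactSupport (partialP i (partialP i f)) := fun i =>
    hasCompactSupport_partialP (hd1 i) (hp i) i
  by_cases hs : s < L
  · have heq : thermo L s θ f = fun x =>
        θ * partialP ⟨s, hs⟩ (partialP ⟨s, hs⟩ f) x - x.2 ⟨s, hs⟩ * partialP ⟨s, hs⟩ f x :=
      funext fun x => thermo_eq hs θ f x
    rw [heq]
    exact ((hpp _).mul_left).sub ((hp _).mul_left)
  · have heq : thermo L s θ f = 0 := funext fun x => thermo_eq_zero_of_le (not_lt.mp hs) θ f x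
    rw [heq]
    exact HasCompactSupport.zero

variable (P : OscillatorChain)

/-- The Gibbs measure is a finite measure (a probability measure or, if `e^{-H/T}` is not
integrable, the zero measure — Mathlib's `Measure.tilted`). [folklore] -/
theorem isFiniteMeasure_gibbsMeasure (L : ℕ) (T : ℝ) : IsFiniteMeasure (P.gibbsMeasure L T) := by
  rw [P.gibbsMeasure_eq]
  infer_instance

/-- **Fluctuation–dissipation at any site.** A unit-strength Ornstein–Uhlenbeck thermostat on
`p_s` at the Gibbs temperature `T ≠ 0` is weakly conservative for `μ_T`:
`∫ (T ∂²_{p_s} f − p_s ∂_{p_s} f) dμ_T = 0` for `f ∈ C²_c` (any `OscillatorChain` with `C¹`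
potentials; `integral_bath_mul_gibbsDensity` with `T_b = T`). [folklore] -/
theorem integral_thermo_gibbsMeasure (hU : ContDiff ℝ 1 P.U) (hV : ContDiff ℝ 1 P.V) (L s : ℕ)
    {T : ℝ} (hT : T ≠ 0) {f : PhaseSpace L → ℝ} (hf : ContDiff ℝ 2 f)
    (hfc : HasCompactSupport f) :
    ∫ x, thermo L s T f x ∂(P.gibbsMeasure L T) = 0 := by
  rw [P.integral_gibbsMeasure]
  by_cases hs : s < L
  · simp_rw [thermo_eq hs]
    rw [P.integral_bath_mul_gibbsDensity hU hV L T T hf hfc ⟨s, hs⟩, div_self hT, sub_self,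
      zero_mul, mul_zero]
  · simp_rw [thermo_eq_zero_of_le (not_lt.mp hs)]
    simp

/-- The device generator at equal terminal temperatures `T` integrates to zero against the Gibbs
state whenever the plain generator does: `∫ L_dev f dμ_T = ∫ L_T f dμ_T` for `f ∈ C²_c`
(`C¹` potentials, `T ≠ 0`). [folklore] -/
theorem integral_deviceGenerator_gibbsMeasure (hU : ContDiff ℝ 1 P.U) (hV : ContDiff ℝ 1 P.V)
    (N M : ℕ) {T : ℝ} (hT : T ≠ 0) {f : PhaseSpace (N + M) → ℝ} (hf : ContDiff ℝ 2 f)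
    (hfc : HasCompactSupport f) :
    ∫ x, deviceGenerator P N M (fun _ => T) f x ∂(P.gibbsMeasure (N + M) T) =
      ∫ x, P.generator (N + M) T T f x ∂(P.gibbsMeasure (N + M) T) := by
  haveI := isFiniteMeasure_gibbsMeasure P (N + M) T
  have hint : ∀ s, Integrable (thermo (N + M) s T f) (P.gibbsMeasure (N + M) T) := fun s =>
    (continuous_thermo s T hf).integrable_of_hasCompactSupport (hasCompactSupport_thermo s T hf hfc)
  have hgen : Integrable (P.generator (N + M) T T f) (P.gibbsMeasure (N + M) T) :=
    (P.continuous_generator hU hV (N + M) T T hf).integrable_of_hasCompactSupport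
      (P.hasCompactSupport_generator (N + M) T T hf hfc)
  have hsum : Integrable (fun x => thermo (N + M) (N - 1) T f x + thermo (N + M) N T f x)
      (P.gibbsMeasure (N + M) T) := (hint _).add (hint _)
  have hsum' : Integrable (fun x => P.γ * (thermo (N + M) (N - 1) T f x + thermo (N + M) N T f x))
      (P.gibbsMeasure (N + M) T) := hsum.const_mul _
  simp only [deviceGenerator]
  rw [integral_add hgen hsum', integral_const_mul, integral_add (hint _) (hint _),
    integral_thermo_gibbsMeasure P hU hV _ _ hT hf hfc,
    integral_thermo_gibbsMeasure P hU hV _ _ hT hf hfc]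
  simp

variable {ω₂ lam β : ℝ}

/-- `p_s²` (in the `kin` form) is integrable for the Gibbs state of the pinned chain
(`kin ≤ 2H ≤ 4T e^{H/(2T)}` and `e^{H/(2T)} ∈ L¹(μ_T)`). [folklore] -/
theorem pinnedChain_integrable_kin_gibbsMeasure (hω : 0 < ω₂) (hl : 0 ≤ lam) (hβ : 0 ≤ β) (γ : ℝ)
    (L s : ℕ) {T : ℝ} (hT : 0 < T) :
    Integrable (kin L s) ((pinnedChain ω₂ lam β γ).gibbsMeasure L T) := by
  have hϑ : 1 / (2 * T) < 1 / T := by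
    rw [one_div_lt_one_div (by positivity) hT]
    linarith
  have hexp := pinnedChain_integrable_exp_mul_hamiltonian_gibbsMeasure hω hl hβ γ L hT hϑ
  refine (hexp.const_mul (4 * T)).mono' (continuous_kin s).aestronglyMeasurable
    (Filter.Eventually.of_forall fun x => ?_)
  rw [Real.norm_eq_abs, abs_of_nonneg (kin_nonneg s x)]
  have h1 := kin_le_sum_sq s x
  have h2 := pinnedChain_harmonic_le_hamiltonian (ω₂ := ω₂) hl hβ γ L x
  have h3 : 0 ≤ ∑ i, ω₂ * x.1 i ^ 2 / 2 := Finset.sum_nonneg fun i _ => by positivity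
  have h4 : ∑ i, x.2 i ^ 2 = 2 * ∑ i, x.2 i ^ 2 / 2 := by
    rw [Finset.mul_sum]
    exact Finset.sum_congr rfl fun i _ => by ring
  have h5 : 1 / (2 * T) * (pinnedChain ω₂ lam β γ).hamiltonian L x ≤
      Real.exp (1 / (2 * T) * (pinnedChain ω₂ lam β γ).hamiltonian L x) := by
    have := Real.add_one_le_exp (1 / (2 * T) * (pinnedChain ω₂ lam β γ).hamiltonian L x)
    linarith
  have hc : 2 * T * (1 / (2 * T)) = 1 := by field_simp
  calc kin L s x ≤ ∑ i, x.2 i ^ 2 := h1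
    _ ≤ 2 * (pinnedChain ω₂ lam β γ).hamiltonian L x := by rw [h4]; linarith
    _ = 4 * T * (1 / (2 * T) * (pinnedChain ω₂ lam β γ).hamiltonian L x) := by
        rw [show 4 * T * (1 / (2 * T) * (pinnedChain ω₂ lam β γ).hamiltonian L x) =
          2 * (2 * T * (1 / (2 * T))) * (pinnedChain ω₂ lam β γ).hamiltonian L x by ring, hc]
        ring
    _ ≤ 4 * T * Real.exp (1 / (2 * T) * (pinnedChain ω₂ lam β γ).hamiltonian L x) :=
        mul_le_mul_of_nonneg_left h5 (by positivity)

/-- **The Gibbs state is an equilibrium steady state of the DEVICE.** For the pinned chain with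
`ω₂ > 0`, `lam, β ≥ 0`, any `γ`, every split `(N, M)` and all four terminal temperatures equal to
`T > 0`, the Gibbs measure `μ_T` of the `(N+M)`-chain is a weak steady state of the γ-probed
device (`IsDeviceSteadyState`): the plain generator is `μ_T`-conservative
(`pinnedChain_isSteadyState_gibbsMeasure`) and so is each junction thermostat at temperature `T`
(`integral_thermo_gibbsMeasure`); the kinetic temperatures are finite. The statement is the line's
`IsDeviceSteadyState (pinnedChain ω₂ lam β γ) N M (fun _ => T) (μ_T)` unfolded (definitionally
equal); it is the `ε = 0` anchor of clause (v) of `DeviceFrame` and the `τ ≡ T` instance of its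
clause (i). [folklore] -/
theorem pinnedChain_isDeviceSteadyState_gibbsMeasure (hω : 0 < ω₂) (hl : 0 ≤ lam) (hβ : 0 ≤ β)
    (γ : ℝ) (N M : ℕ) {T : ℝ} (hT : 0 < T) :
    IsProbabilityMeasure ((pinnedChain ω₂ lam β γ).gibbsMeasure (N + M) T) ∧
      (∀ f : PhaseSpace (N + M) → ℝ, ContDiff ℝ ∞ f → HasCompactSupport f →
        ∫ x, deviceGenerator (pinnedChain ω₂ lam β γ) N M (fun _ => T) f x
          ∂((pinnedChain ω₂ lam β γ).gibbsMeasure (N + M) T) = 0) ∧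
      ∀ s : ℕ, Integrable (kin (N + M) s) ((pinnedChain ω₂ lam β γ).gibbsMeasure (N + M) T) := by
  refine ⟨pinnedChain_isProbabilityMeasure_gibbsMeasure hω hl hβ γ _ hT, fun f hf hfc => ?_,
    fun s => pinnedChain_integrable_kin_gibbsMeasure hω hl hβ γ _ s hT⟩
  have hf2 : ContDiff ℝ 2 f := hf.of_le (by norm_cast)
  rw [integral_deviceGenerator_gibbsMeasure (pinnedChain ω₂ lam β γ)
    (pinnedChain_contDiff_U ω₂ lam β γ) (pinnedChain_contDiff_V ω₂ lam β γ) N M hT.ne' hf2 hfc]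
  exact (pinnedChain_isSteadyState_gibbsMeasure hω hl hβ γ (N + M) hT).2.1 f hf hfc

end Helpers

/-- Registered helper sub-goal `helper_deviceGibbs` (= `pinnedChain_isDeviceSteadyState_gibbsMeasure`
in stub form): the Gibbs state is a weak steady state of the device at equal temperatures. [folklore] -/
theorem helper_deviceGibbs : ∀ (ω₂ lam β γ : ℝ), 0 < ω₂ → 0 ≤ lam → 0 ≤ β → ∀ (N M : ℕ) (T : ℝ), 0 < T → IsProbabilityMeasure ((pinnedChain ω₂ lam β γ).gibbsMeasure (N + M) T) ∧ (∀ f : PhaseSpace (N + M) → ℝ, ContDiff ℝ ∞ f → HasCompactSupport f → ∫ x, deviceGenerator (pinnedChain ω₂ lam β γ) N M (fun _ => T) f x ∂((pinnedChain ω₂ lam β γ).gibbsMeasure (N + M) T) = 0) ∧ ∀ s : ℕ, Integrable (kin (N + M) s) ((pinnedChain ω₂ lam β γ).gibbsMeasure (N + M) T) :=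
  fun _ _ _ γ hω hl hβ N M _ hT => pinnedChain_isDeviceSteadyState_gibbsMeasure hω hl hβ γ N M hT

end Summit.AtomisticToContinuum.FouriersLaw.Theorems.SuperadditiveResistance.DeviceLiouville

end
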